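/-
Copyright (c) 2026 the pub-hodgecm-mathlib formalisation cell (harness21).  Prover seat hodgecm-mathlib-K2E4-p14 (g6), Track B ∕ K2-LIT, h413 =
`stmt-HodgeConjecture-24833`, line `K2_E1_TraceFormulaBeta`, campaign «EIS-RANK-ONE» rung R6k «SPHERICAL BRACKETS», the `U(J₂)` twin (RULING of the dealer K2E1-plan (g4)
2026-09-04T07:03:01Z: «`_two` → YOU after this file»).
-/
import Summits.HodgeConjecture.HodgeConjecture.Theorems.K2E1IntertwiningGrowthU2                -- ★ p857923 (this seat, g5): [D8]₂ real standard intertwining integral of `U(J₂)`, §1 rows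
import Summits.HodgeConjecture.HodgeConjecture.Theorems.K2E1MaassSelbergSphericalBracketsCMThree  -- ★ p858169∕p858174 (this seat): `idelicBracket_pos`, `idelicBracket_eq_ofReal` (E-generic, `N`-free)
import Summits.HodgeConjecture.HodgeConjecture.Theorems.K2E1MaassSelbergCMTwoFinalPair         -- ★ p858214 (K2E1-p09 g5): «CM-FINAL-2» ED. 2 `cm_two_final′`, `cm_two_final_const′` (ED. 2 of this file)
import HarnessLib

/-!
# K2·E1 — `K2E1MaassSelbergSphericalBracketsCMTwo`: THE `U(J₂)` TWIN OF «(R6k) SPHERICAL BRACKETS» — THE COMPLEX-EXPONENT STANDARD INTERTWINING INTEGRAL AND THE CONSTANT `K_U`-AVERAGES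
# (campaign «EIS-RANK-ONE», rung R6k, dealer K2E1-plan (g4) 2026-09-04T07:03:01Z; `2ρ_H = 1`: exponents `1 − w`, `z − 1` where `U(J₃)` has `2 − w`, `z − 2`)

Track B ∕ K2-LIT, crux h413 = `stmt-HodgeConjecture-24833`, route of record `HCCMUnconditional`; cell `hodgecm-mathlib`, squad K2, ENGINE E1.  Prover seat
`hodgecm-mathlib-K2E4-p14` (g6).  THEOREMS ONLY (no `def`, no `instance`, no notation, no named-fact hypothesis, no `sorry`); lane `--supports stmt-HodgeConjecture-24833 --as helper`
(count-neutral).  Closes no socket.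

THE MATHEMATICS [MoeglinWaldspurger1995, II.1.6–II.1.7, IV.2.3; Garrett2018, §2.8, §11.3].  `G = U(J₂)(𝔸_F)`, `N(𝔸)` abelian, `2ρ_H = 1`.  §1 the ℂ-twin of ★ [D8]₂ §2–§3:
**`∫_{N(𝔸)} H(w₀ v g)^w dν(v) = c(w)·H(g)^{1−w}`, `c(w) := ∫_{N(𝔸)} H(w₀ v)^w dν(v) ∈ ℂ`**, every `g`, every `w : ℂ`, no convergence hypothesis (torus scaling ★
`map_torusConj_eq_torusRootModulus_smul_two`, Iwasawa `hBK`, Levi ★ `torusPart`, `δ_B(t) = ‖d₀‖ = H(t n)` ★).  §2 `intertwinedCoeff_const`: at `φ ≡ φ₀` the intertwined coefficient of ★ ED. 5₂ is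
`(∫ φ₀H(w₀vg)^z dν)·H(g)^{z−1} = c(z)·φ₀`.  §3 the four `K_U`-averages of ★ [D8]₂ `maassSelberg_flatSectionU_two_fin` at constant coefficients are the constants `m·φ₀·conj φ₀′`,
`m·φ₀·conj(c(z′)φ₀′)`, `m·c(z)φ₀·conj φ₀′`, `m·c(z)φ₀·conj(c(z′)φ₀′)` (`m = μ_K(K_U) > 0`, `measureReal_maximalCompact_pos`); the bracket scalar `κ` is the `N`-free ★ `idelicBracket_pos`∕
`idelicBracket_eq_ofReal`.  The CM corollary over the «CM-FINAL-2» ED. 2 head of K2E1-p09 (g5) follows by the append protocol once that head is ★.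
HONEST LABEL: HC_CM is proved only modulo the 7 printed citations (2 remaining named inputs: hLiu418 = `stmt-HodgeConjecture-24832`, h413 = `stmt-HodgeConjecture-24833`) until rung 0
closes; this file asserts no named fact and closes no socket.
References: [MoeglinWaldspurger1995] II.1.6–II.1.7, IV.2.3 · [Garrett2018] §2.2, §2.8, §11.3 · [Rogawski1990] §1.10, §2.2.
-/

set_option autoImplicit false
-- the mandated namespace repeats the single-problem summit's segment (`HodgeConjecture.HodgeConjecture`)
set_option linter.dupNamespace false

noncomputable section

open MeasureTheory Measure NumberField IsDedekindDomain Set MulAction Filter Matrix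
open scoped ENNReal NNReal ComplexConjugate MatrixGroups
open Literature.MeasureTheory.Group Literature.NumberTheory
open Literature.NumberTheory.Automorphic Literature.NumberTheory.Automorphic.UnitaryGroup AdelicGroupData
open Summit.HodgeConjecture.HodgeConjecture.Cruxes.H413.K2E1BorelEisensteinU
open Summit.HodgeConjecture.HodgeConjecture.Cruxes.H413.K2E1MaassSelbergBracketsThree
open Summit.HodgeConjecture.HodgeConjecture.Cruxes.H413.K2E1IntertwiningGrowthU2
open Summit.HodgeConjecture.HodgeConjecture.Cruxes.H413.K2E1HeightFunctionU3 (borelHeight_one)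

namespace Summit.HodgeConjecture.HodgeConjecture.Cruxes.H413.K2E1MaassSelbergSphericalBracketsCMTwo

/-! ## §1 The complex-exponent standard intertwining integral of `U(J₂)`: `∫ H(w₀ v g)^w dν = c(w)·H(g)^{1−w}`, `w : ℂ` -/

section Generic

variable {F E : Type} [Field F] [NumberField F] [Field E] [NumberField E] [Algebra F E] {c : E ≃ₐ[F] E}
variable [MeasurableSpace (quasiSplit F E c 2).Adelic] [BorelSpace (quasiSplit F E c 2).Adelic]

/-- **`∫ H(w₀ v t x)^w dν(v) = δ_B(t) · ‖d₀‖^{−w} · ∫ H(w₀ v x)^w dν(v)`** for `t = diag(d) ∈ T(𝔸_F)` and COMPLEX `w` (the ℂ-twin of ★ [D8]₂ `integral_borelHeight_weylLongU_torus_mul_rpow`: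
substitute `v = t u t⁻¹`, ★ `map_torusConj_eq_torusRootModulus_smul`, and ★ [D8]₂ §1 `H(w₀ t x) = ‖d₀‖⁻¹ H(w₀ x)` pointwise with `Complex.mul_cpow_ofReal_nonneg`).
[cite: MoeglinWaldspurger1995, II.1.6] [cite: Garrett2018, §2.8] -/
theorem integral_borelHeight_weylLongU_torus_mul_cpow (hc : c * c = 1) (hc1 : c ≠ 1) (ν : Measure ↥(adelicUnipotent F E c 2)) [ν.IsHaarMeasure]
    (t : torusInBorel F E c 2) {d : Fin 2 → (AdeleRing (𝓞 E) E)ˣ}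
    (hd : glDiagonal 2 (AdeleRing (𝓞 E) E) d = adelicVal F E c 2 _ ((t : borelAdelic F E c 2) : (quasiSplit F E c 2).Adelic)) (w : ℂ) (x : (quasiSplit F E c 2).Adelic) :
    ∫ v : ↥(adelicUnipotent F E c 2), (((borelHeight ((quasiSplit F E c 2).toAdelic (weylLongU (c : E →+* E) (rfl : (StdForm.antidiagonal 2).over E = (StdForm.antidiagonal 2).over E)) * ((v : (quasiSplit F E c 2).Adelic) * (((t : borelAdelic F E c 2) : (quasiSplit F E c 2).Adelic) * x)))) : ℝ) : ℂ) ^ w ∂ν =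
      ((torusRootModulus E 2 d : ℝ) : ℂ) * ((((IdeleClassGroup.ideleNorm E (d 0) : ℝ) : ℂ) ^ w)⁻¹ *
        ∫ v : ↥(adelicUnipotent F E c 2), (((borelHeight ((quasiSplit F E c 2).toAdelic (weylLongU (c : E →+* E) (rfl : (StdForm.antidiagonal 2).over E = (StdForm.antidiagonal 2).over E)) * ((v : (quasiSplit F E c 2).Adelic) * x))) : ℝ) : ℂ) ^ w ∂ν) := by
  haveI := locallyCompactSpace_adeleRing' E
  letI : MeasurableSpace (AdeleRing (𝓞 E) E) := borel _
  haveI : BorelSpace (AdeleRing (𝓞 E) E) := ⟨rfl⟩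
  set T : (quasiSplit F E c 2).Adelic := ((t : borelAdelic F E c 2) : (quasiSplit F E c 2).Adelic) with hT
  -- the integrand as a function of `u = t⁻¹ v t`
  set Φ : ↥(adelicUnipotent F E c 2) → ℂ := fun u => (((borelHeight ((quasiSplit F E c 2).toAdelic (weylLongU (c : E →+* E) (rfl : (StdForm.antidiagonal 2).over E = (StdForm.antidiagonal 2).over E)) * (T * ((u : (quasiSplit F E c 2).Adelic) * x)))) : ℝ) : ℂ) ^ w with hΦ
  have hΦm : Measurable Φ :=
    (Complex.measurable_ofReal.comp (measurable_borelHeight.comp (continuous_const.mul (continuous_const.mul (continuous_subtype_val.mul continuous_const))).measurable).coe_nnreal_real).pow_const w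
  have hκ : Measurable fun u : ↥(adelicUnipotent F E c 2) => (⟨T⁻¹ * (u : (quasiSplit F E c 2).Adelic) * T, conj_mem_adelicUnipotent (t : borelAdelic F E c 2).2 u.2⟩ : ↥(adelicUnipotent F E c 2)) :=
    ((continuous_const.mul continuous_subtype_val).mul continuous_const).measurable.subtype_mk
  have h1 : (fun v : ↥(adelicUnipotent F E c 2) => (((borelHeight ((quasiSplit F E c 2).toAdelic (weylLongU (c : E →+* E) (rfl : (StdForm.antidiagonal 2).over E = (StdForm.antidiagonal 2).over E)) * ((v : (quasiSplit F E c 2).Adelic) * (T * x)))) : ℝ) : ℂ) ^ w) =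
      fun v : ↥(adelicUnipotent F E c 2) => Φ (⟨T⁻¹ * (v : (quasiSplit F E c 2).Adelic) * T, conj_mem_adelicUnipotent (t : borelAdelic F E c 2).2 v.2⟩ : ↥(adelicUnipotent F E c 2)) := by
    funext v
    simp only [hΦ]
    rw [show T * (T⁻¹ * (v : (quasiSplit F E c 2).Adelic) * T * x) = (v : (quasiSplit F E c 2).Adelic) * (T * x) by group]
  have hpos : (0 : ℝ) < (IdeleClassGroup.ideleNorm E (d 0) : ℝ) := ideleNorm_real_pos _
  have harg : (((IdeleClassGroup.ideleNorm E (d 0) : ℝ) : ℂ)).arg ≠ Real.pi := by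
    rw [Complex.arg_ofReal_of_nonneg hpos.le]; exact Real.pi_ne_zero.symm
  have h2 : ∀ u : ↥(adelicUnipotent F E c 2), Φ u = (((IdeleClassGroup.ideleNorm E (d 0) : ℝ) : ℂ) ^ w)⁻¹ * (((borelHeight ((quasiSplit F E c 2).toAdelic (weylLongU (c : E →+* E) (rfl : (StdForm.antidiagonal 2).over E = (StdForm.antidiagonal 2).over E)) * ((u : (quasiSplit F E c 2).Adelic) * x))) : ℝ) : ℂ) ^ w := by
    intro u
    simp only [hΦ]
    rw [borelHeight_weylLongU_mul_diag_mul hd, NNReal.coe_mul, NNReal.coe_inv, Complex.ofReal_mul,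
      Complex.mul_cpow_ofReal_nonneg (inv_nonneg.2 (NNReal.coe_nonneg _)) (NNReal.coe_nonneg _), Complex.ofReal_inv, Complex.inv_cpow _ _ harg]
  rw [h1, ← integral_map hκ.aemeasurable hΦm.aestronglyMeasurable, map_torusConj_eq_torusRootModulus_smul_two hc hc1 ν t hd, integral_smul_measure,
    ENNReal.coe_toReal]
  simp_rw [h2]
  rw [integral_const_mul, Complex.real_smul]

/-- **THE COMPLEX-EXPONENT STANDARD INTERTWINING INTEGRAL OF `U(J₂)`**: `∫_{N(𝔸)} H(w₀ v g)^w dν(v) = c(w)·H(g)^{1−w}`, `c(w) := ∫_{N(𝔸)} H(w₀ v)^w dν(v) ∈ ℂ`, for every `g` and every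
`w : ℂ` (the ℂ-twin of ★ [D8]₂ `integral_borelHeight_weylLongU_mul_rpow_eq`: Iwasawa `g = b k` ★ `hBK` and right-`K_U`-invariance of `H` ★; Levi `b = t n` ★ `torusPart`; the torus scaling above;
`N(𝔸)` abelian ★; `δ_B(t) = ‖d₀‖`, `H(b) = ‖d₀‖` ★ torus relations).  No convergence hypothesis: both sides carry the same Bochner junk. [cite: MoeglinWaldspurger1995, II.1.6]
[cite: Garrett2018, §2.8] [cite: Rogawski1990, §2.2] -/
theorem integral_borelHeight_weylLongU_mul_cpow_eq (hc : c * c = 1) (hc1 : c ≠ 1) (ν : Measure ↥(adelicUnipotent F E c 2)) [ν.IsHaarMeasure]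
    (hBK : ∀ g : (quasiSplit F E c 2).Adelic, ∃ b ∈ borelAdelic F E c 2, ∃ k : (quasiSplit F E c 2).Adelic, adelicVal F E c 2 ((StdForm.antidiagonal 2).over E) k ∈ standardMaximalCompactGL 2 E ∧ g = b * k)
    (w : ℂ) (g : (quasiSplit F E c 2).Adelic) :
    ∫ v : ↥(adelicUnipotent F E c 2), (((borelHeight ((quasiSplit F E c 2).toAdelic (weylLongU (c : E →+* E) (rfl : (StdForm.antidiagonal 2).over E = (StdForm.antidiagonal 2).over E)) * ((v : (quasiSplit F E c 2).Adelic) * g))) : ℝ) : ℂ) ^ w ∂ν =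
      (∫ v : ↥(adelicUnipotent F E c 2), (((borelHeight ((quasiSplit F E c 2).toAdelic (weylLongU (c : E →+* E) (rfl : (StdForm.antidiagonal 2).over E = (StdForm.antidiagonal 2).over E)) * (v : (quasiSplit F E c 2).Adelic))) : ℝ) : ℂ) ^ w ∂ν) * ((borelHeight g : ℝ) : ℂ) ^ (1 - w) := by
  haveI := locallyCompactSpace_adeleRing' E
  haveI := isMulRightInvariant_of_isMulLeftInvariant_two ν
  obtain ⟨b, hb, k, hk, rfl⟩ := hBK g
  have hkK : k ∈ ((standardMaximalCompactGL 2 E).comap (adelicVal F E c 2 ((StdForm.antidiagonal 2).over E)) : Subgroup (quasiSplit F E c 2).Adelic) := Subgroup.mem_comap.2 hk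
  -- strip `k`
  have e1 : ∀ v : ↥(adelicUnipotent F E c 2), borelHeight ((quasiSplit F E c 2).toAdelic (weylLongU (c : E →+* E) (rfl : (StdForm.antidiagonal 2).over E = (StdForm.antidiagonal 2).over E)) * ((v : (quasiSplit F E c 2).Adelic) * (b * k))) = borelHeight ((quasiSplit F E c 2).toAdelic (weylLongU (c : E →+* E) (rfl : (StdForm.antidiagonal 2).over E = (StdForm.antidiagonal 2).over E)) * ((v : (quasiSplit F E c 2).Adelic) * b)) := fun v => by
    rw [show (quasiSplit F E c 2).toAdelic (weylLongU (c : E →+* E) (rfl : (StdForm.antidiagonal 2).over E = (StdForm.antidiagonal 2).over E)) * ((v : (quasiSplit F E c 2).Adelic) * (b * k)) = (quasiSplit F E c 2).toAdelic (weylLongU (c : E →+* E) (rfl : (StdForm.antidiagonal 2).over E = (StdForm.antidiagonal 2).over E)) * ((v : (quasiSplit F E c 2).Adelic) * b) * k by group]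
    exact borelHeight_mul_of_mem_comap_standardMaximalCompactGL hkK _
  simp_rw [e1]
  rw [borelHeight_mul_of_mem_comap_standardMaximalCompactGL hkK b]
  -- Levi `b = t n`
  set tB : torusInBorel F E c 2 := ⟨torusPart ⟨b, hb⟩, (mem_torusInBorel_iff _).2 (torusPart_mem_torusAdelic _)⟩ with htB
  have hd : glDiagonal 2 (AdeleRing (𝓞 E) E) (diagUnit hb) = adelicVal F E c 2 _ ((tB : borelAdelic F E c 2) : (quasiSplit F E c 2).Adelic) := (adelicVal_torusPart ⟨b, hb⟩).symm
  have hn : (((tB : borelAdelic F E c 2) : (quasiSplit F E c 2).Adelic))⁻¹ * b ∈ adelicUnipotent F E c 2 := torusPart_inv_mul_mem_adelicUnipotent ⟨b, hb⟩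
  have key := integral_borelHeight_weylLongU_torus_mul_cpow hc hc1 ν tB hd w ((((tB : borelAdelic F E c 2) : (quasiSplit F E c 2).Adelic))⁻¹ * b)
  rw [mul_inv_cancel_left] at key
  -- `N(𝔸)` unimodular: right-translate by `n`
  have e2 : ∫ v : ↥(adelicUnipotent F E c 2), (((borelHeight ((quasiSplit F E c 2).toAdelic (weylLongU (c : E →+* E) (rfl : (StdForm.antidiagonal 2).over E = (StdForm.antidiagonal 2).over E)) * ((v : (quasiSplit F E c 2).Adelic) * ((((tB : borelAdelic F E c 2) : (quasiSplit F E c 2).Adelic))⁻¹ * b)))) : ℝ) : ℂ) ^ w ∂ν =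
      ∫ v : ↥(adelicUnipotent F E c 2), (((borelHeight ((quasiSplit F E c 2).toAdelic (weylLongU (c : E →+* E) (rfl : (StdForm.antidiagonal 2).over E = (StdForm.antidiagonal 2).over E)) * (v : (quasiSplit F E c 2).Adelic))) : ℝ) : ℂ) ^ w ∂ν := by
    have h := integral_mul_right_eq_self (μ := ν) (fun v : ↥(adelicUnipotent F E c 2) => (((borelHeight ((quasiSplit F E c 2).toAdelic (weylLongU (c : E →+* E) (rfl : (StdForm.antidiagonal 2).over E = (StdForm.antidiagonal 2).over E)) * (v : (quasiSplit F E c 2).Adelic))) : ℝ) : ℂ) ^ w) ⟨_, hn⟩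
    simpa only [Subgroup.coe_mul] using h
  rw [key, e2]
  -- torus relations: `δ_B(t) = ‖d₀‖`, `H(b) = H(t n) = ‖d₁‖⁻¹ = ‖d₀‖`
  have hδ : (torusRootModulus E 2 (diagUnit hb) : ℝ) = (IdeleClassGroup.ideleNorm E (diagUnit hb 0) : ℝ) := by
    rw [torusRootModulus_two_eq tB hd, AdeleRing.distribHaarChar_eq_ideleNorm]
  have hHb : (borelHeight b : ℝ) = (IdeleClassGroup.ideleNorm E (diagUnit hb 0) : ℝ) := by
    have h2 := distribHaarChar_torus_two tB hd
    rw [AdeleRing.distribHaarChar_eq_ideleNorm, AdeleRing.distribHaarChar_eq_ideleNorm] at h2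
    have hlast : lastEntryUnit (tB : borelAdelic F E c 2).2 = diagUnit hb 1 := Units.ext (coe_lastEntryUnit_of_glDiagonal_eq hd)
    conv_lhs => rw [← mul_inv_cancel_left (((tB : borelAdelic F E c 2) : (quasiSplit F E c 2).Adelic)) b, borelHeight_borel_mul (tB : borelAdelic F E c 2).2,
      show (((tB : borelAdelic F E c 2) : (quasiSplit F E c 2).Adelic))⁻¹ * b = ((((tB : borelAdelic F E c 2) : (quasiSplit F E c 2).Adelic))⁻¹ * b) * 1 from (mul_one _).symm,
      borelHeight_unipotent_mul hn, borelHeight_one, mul_one, hlast, h2, inv_inv]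
  have hpos : (0 : ℝ) < (IdeleClassGroup.ideleNorm E (diagUnit hb 0) : ℝ) := ideleNorm_real_pos _
  have ha0 : ((IdeleClassGroup.ideleNorm E (diagUnit hb 0) : ℝ) : ℂ) ≠ 0 := Complex.ofReal_ne_zero.2 hpos.ne'
  have haw : ((IdeleClassGroup.ideleNorm E (diagUnit hb 0) : ℝ) : ℂ) ^ w ≠ 0 := fun h => ha0 ((Complex.cpow_eq_zero_iff _ _).1 h).1
  rw [hδ, hHb, Complex.cpow_sub _ _ ha0, Complex.cpow_one]
  field_simp

/-! ## §2 The intertwined coefficient of a CONSTANT section is the constant `c(z)·φ₀` -/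

/-- **`φ̃ ≡ c(z)·φ₀` FOR `φ ≡ φ₀`**: `(∫_{N(𝔸)} φ₀·H(w₀ v g)^z dν(v))·H(g)^{z−2} = φ₀·c(z)·H(g)^{(1−z)+(z−1)} = c(z)·φ₀` (§1 and `H(g) ≠ 0`) — the intertwined coefficient of ★ ED. 5 at the
spherical vector. [cite: MoeglinWaldspurger1995, II.1.6] [cite: Garrett2018, §2.8] -/
theorem intertwinedCoeff_const (hc : c * c = 1) (hc1 : c ≠ 1) (ν : Measure ↥(adelicUnipotent F E c 2)) [ν.IsHaarMeasure]
    (hBK : ∀ g : (quasiSplit F E c 2).Adelic, ∃ b ∈ borelAdelic F E c 2, ∃ k : (quasiSplit F E c 2).Adelic, adelicVal F E c 2 ((StdForm.antidiagonal 2).over E) k ∈ standardMaximalCompactGL 2 E ∧ g = b * k)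
    (φ₀ z : ℂ) (g : (quasiSplit F E c 2).Adelic) :
    (∫ v : ↥(adelicUnipotent F E c 2), flatSectionU (fun _ : (quasiSplit F E c 2).Adelic => φ₀) z ((quasiSplit F E c 2).toAdelic (weylLongU (c : E →+* E) (rfl : (StdForm.antidiagonal 2).over E = (StdForm.antidiagonal 2).over E)) * ((v : (quasiSplit F E c 2).Adelic) * g)) ∂ν) * ((borelHeight g : ℝ) : ℂ) ^ (z - 1) =
      (∫ v : ↥(adelicUnipotent F E c 2), (((borelHeight ((quasiSplit F E c 2).toAdelic (weylLongU (c : E →+* E) (rfl : (StdForm.antidiagonal 2).over E = (StdForm.antidiagonal 2).over E)) * (v : (quasiSplit F E c 2).Adelic))) : ℝ) : ℂ) ^ z ∂ν) * φ₀ := by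
  have hne : ((borelHeight g : ℝ) : ℂ) ≠ 0 := Complex.ofReal_ne_zero.2 (ne_of_gt (by exact_mod_cast borelHeight_pos g))
  simp only [flatSectionU_apply]
  rw [integral_const_mul, integral_borelHeight_weylLongU_mul_cpow_eq hc hc1 ν hBK z g, mul_assoc, mul_assoc, ← Complex.cpow_add _ _ hne,
    show (1 : ℂ) - z + (z - 1) = 0 by ring, Complex.cpow_zero, mul_one, mul_comm]

/-! ## §3 The four `K_U`-averages at constant coefficients are constants (`m := μ_K(K_U)`, finite: `K_U` compact ★) -/

omit [BorelSpace (quasiSplit F E c 2).Adelic] in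
/-- `K_U` is compact (★ `isCompact_comap_adelicVal_standardMaximalCompactGL`), so a Haar measure `μ_K` on it is finite and `∫_{K_U} C dμ_K = μ_K(K_U)·C`. [folklore] -/
theorem integral_maximalCompact_const (μK : Measure ((standardMaximalCompactGL 2 E).comap (adelicVal F E c 2 ((StdForm.antidiagonal 2).over E)) : Subgroup (quasiSplit F E c 2).Adelic)) [μK.IsHaarMeasure] (C : ℂ) :
    ∫ _ : ((standardMaximalCompactGL 2 E).comap (adelicVal F E c 2 ((StdForm.antidiagonal 2).over E)) : Subgroup (quasiSplit F E c 2).Adelic), C ∂μK = ((μK.real Set.univ : ℝ) : ℂ) * C := by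
  have hKc : IsCompact (((standardMaximalCompactGL 2 E).comap (adelicVal F E c 2 ((StdForm.antidiagonal 2).over E)) : Subgroup (quasiSplit F E c 2).Adelic) : Set (quasiSplit F E c 2).Adelic) :=
    isCompact_comap_adelicVal_standardMaximalCompactGL
  haveI : CompactSpace ((standardMaximalCompactGL 2 E).comap (adelicVal F E c 2 ((StdForm.antidiagonal 2).over E)) : Subgroup (quasiSplit F E c 2).Adelic) := isCompact_iff_compactSpace.1 hKc
  haveI : IsFiniteMeasure μK := CompactSpace.isFiniteMeasure
  rw [integral_const, Complex.real_smul]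

omit [BorelSpace (quasiSplit F E c 2).Adelic] in
/-- **`Ξ₁ ≡ m·φ₀·conj φ₀′`**: the `K_U`-average of `φ·conj φ′` along `t·K_U` at constant coefficients (the `hΞ₁` datum of ★ ED. 6 ∕ «CM-FINAL»). [cite: MoeglinWaldspurger1995, II.1.7] -/
theorem average_const_mul_conj_const (μK : Measure ((standardMaximalCompactGL 2 E).comap (adelicVal F E c 2 ((StdForm.antidiagonal 2).over E)) : Subgroup (quasiSplit F E c 2).Adelic)) [μK.IsHaarMeasure]
    (φ₀ φ₀' : ℂ) (t : torusInBorel F E c 2) :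
    ∫ _ : ((standardMaximalCompactGL 2 E).comap (adelicVal F E c 2 ((StdForm.antidiagonal 2).over E)) : Subgroup (quasiSplit F E c 2).Adelic), φ₀ * conj φ₀' ∂μK =
      (fun _ : (AdeleRing (𝓞 E) E)ˣ => ((μK.real Set.univ : ℝ) : ℂ) * (φ₀ * conj φ₀')) (diagUnit (t : borelAdelic F E c 2).2 0) :=
  integral_maximalCompact_const μK _

/-- **`Ξ₂ ≡ m·φ₀·conj(c(z′)·φ₀′)`**: the `K_U`-average of `φ·conj φ̃′` along `t·K_U` at constant coefficients — `φ̃′ ≡ c(z′)·φ₀′` by §2 (the `hΞ₂` datum, ED. 6's integrand shape).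
[cite: MoeglinWaldspurger1995, II.1.7] -/
theorem average_const_mul_conj_intertwinedCoeff_const (hc : c * c = 1) (hc1 : c ≠ 1) (ν : Measure ↥(adelicUnipotent F E c 2)) [ν.IsHaarMeasure]
    (hBK : ∀ g : (quasiSplit F E c 2).Adelic, ∃ b ∈ borelAdelic F E c 2, ∃ k : (quasiSplit F E c 2).Adelic, adelicVal F E c 2 ((StdForm.antidiagonal 2).over E) k ∈ standardMaximalCompactGL 2 E ∧ g = b * k)
    (μK : Measure ((standardMaximalCompactGL 2 E).comap (adelicVal F E c 2 ((StdForm.antidiagonal 2).over E)) : Subgroup (quasiSplit F E c 2).Adelic)) [μK.IsHaarMeasure]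
    (φ₀ φ₀' z' : ℂ) (t : torusInBorel F E c 2) :
    ∫ k : ((standardMaximalCompactGL 2 E).comap (adelicVal F E c 2 ((StdForm.antidiagonal 2).over E)) : Subgroup (quasiSplit F E c 2).Adelic),
        φ₀ * conj ((∫ v : ↥(adelicUnipotent F E c 2), flatSectionU (fun _ : (quasiSplit F E c 2).Adelic => φ₀') z' ((quasiSplit F E c 2).toAdelic (weylLongU (c : E →+* E) (rfl : (StdForm.antidiagonal 2).over E = (StdForm.antidiagonal 2).over E)) * ((v : (quasiSplit F E c 2).Adelic) * (((t : borelAdelic F E c 2) : (quasiSplit F E c 2).Adelic) * (k : (quasiSplit F E c 2).Adelic)))) ∂ν) *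
          ((borelHeight (((t : borelAdelic F E c 2) : (quasiSplit F E c 2).Adelic) * (k : (quasiSplit F E c 2).Adelic)) : ℝ) : ℂ) ^ (z' - 1)) ∂μK =
      (fun _ : (AdeleRing (𝓞 E) E)ˣ => ((μK.real Set.univ : ℝ) : ℂ) * (φ₀ * conj ((∫ v : ↥(adelicUnipotent F E c 2), (((borelHeight ((quasiSplit F E c 2).toAdelic (weylLongU (c : E →+* E) (rfl : (StdForm.antidiagonal 2).over E = (StdForm.antidiagonal 2).over E)) * (v : (quasiSplit F E c 2).Adelic))) : ℝ) : ℂ) ^ z' ∂ν) * φ₀')))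
        (diagUnit (t : borelAdelic F E c 2).2 0) := by
  simp_rw [intertwinedCoeff_const hc hc1 ν hBK φ₀' z']
  exact integral_maximalCompact_const μK _

/-- **`Ξ₃ ≡ m·c(z)φ₀·conj φ₀′`**: the `K_U`-average of `φ̃·conj φ′` along `t·K_U` at constant coefficients (the `hΞ₃` datum, ED. 6's integrand shape). [cite: MoeglinWaldspurger1995, II.1.7] -/
theorem average_intertwinedCoeff_const_mul_conj_const (hc : c * c = 1) (hc1 : c ≠ 1) (ν : Measure ↥(adelicUnipotent F E c 2)) [ν.IsHaarMeasure]
    (hBK : ∀ g : (quasiSplit F E c 2).Adelic, ∃ b ∈ borelAdelic F E c 2, ∃ k : (quasiSplit F E c 2).Adelic, adelicVal F E c 2 ((StdForm.antidiagonal 2).over E) k ∈ standardMaximalCompactGL 2 E ∧ g = b * k)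
    (μK : Measure ((standardMaximalCompactGL 2 E).comap (adelicVal F E c 2 ((StdForm.antidiagonal 2).over E)) : Subgroup (quasiSplit F E c 2).Adelic)) [μK.IsHaarMeasure]
    (φ₀ φ₀' z : ℂ) (t : torusInBorel F E c 2) :
    ∫ k : ((standardMaximalCompactGL 2 E).comap (adelicVal F E c 2 ((StdForm.antidiagonal 2).over E)) : Subgroup (quasiSplit F E c 2).Adelic),
        (∫ v : ↥(adelicUnipotent F E c 2), flatSectionU (fun _ : (quasiSplit F E c 2).Adelic => φ₀) z ((quasiSplit F E c 2).toAdelic (weylLongU (c : E →+* E) (rfl : (StdForm.antidiagonal 2).over E = (StdForm.antidiagonal 2).over E)) * ((v : (quasiSplit F E c 2).Adelic) * (((t : borelAdelic F E c 2) : (quasiSplit F E c 2).Adelic) * (k : (quasiSplit F E c 2).Adelic)))) ∂ν) *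
          ((borelHeight (((t : borelAdelic F E c 2) : (quasiSplit F E c 2).Adelic) * (k : (quasiSplit F E c 2).Adelic)) : ℝ) : ℂ) ^ (z - 1) * conj φ₀' ∂μK =
      (fun _ : (AdeleRing (𝓞 E) E)ˣ => ((μK.real Set.univ : ℝ) : ℂ) * ((∫ v : ↥(adelicUnipotent F E c 2), (((borelHeight ((quasiSplit F E c 2).toAdelic (weylLongU (c : E →+* E) (rfl : (StdForm.antidiagonal 2).over E = (StdForm.antidiagonal 2).over E)) * (v : (quasiSplit F E c 2).Adelic))) : ℝ) : ℂ) ^ z ∂ν) * φ₀ * conj φ₀'))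
        (diagUnit (t : borelAdelic F E c 2).2 0) := by
  simp_rw [intertwinedCoeff_const hc hc1 ν hBK φ₀ z]
  exact integral_maximalCompact_const μK _

/-- **`Ξ₄ ≡ m·c(z)φ₀·conj(c(z′)φ₀′)`**: the `K_U`-average of `φ̃·conj φ̃′` along `t·K_U` at constant coefficients (the `hΞ₄` datum, ED. 6's integrand shape). [cite: MoeglinWaldspurger1995, II.1.7] -/
theorem average_intertwinedCoeff_const_mul_conj_intertwinedCoeff_const (hc : c * c = 1) (hc1 : c ≠ 1) (ν : Measure ↥(adelicUnipotent F E c 2)) [ν.IsHaarMeasure]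
    (hBK : ∀ g : (quasiSplit F E c 2).Adelic, ∃ b ∈ borelAdelic F E c 2, ∃ k : (quasiSplit F E c 2).Adelic, adelicVal F E c 2 ((StdForm.antidiagonal 2).over E) k ∈ standardMaximalCompactGL 2 E ∧ g = b * k)
    (μK : Measure ((standardMaximalCompactGL 2 E).comap (adelicVal F E c 2 ((StdForm.antidiagonal 2).over E)) : Subgroup (quasiSplit F E c 2).Adelic)) [μK.IsHaarMeasure]
    (φ₀ φ₀' z z' : ℂ) (t : torusInBorel F E c 2) :
    ∫ k : ((standardMaximalCompactGL 2 E).comap (adelicVal F E c 2 ((StdForm.antidiagonal 2).over E)) : Subgroup (quasiSplit F E c 2).Adelic),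
        (∫ v : ↥(adelicUnipotent F E c 2), flatSectionU (fun _ : (quasiSplit F E c 2).Adelic => φ₀) z ((quasiSplit F E c 2).toAdelic (weylLongU (c : E →+* E) (rfl : (StdForm.antidiagonal 2).over E = (StdForm.antidiagonal 2).over E)) * ((v : (quasiSplit F E c 2).Adelic) * (((t : borelAdelic F E c 2) : (quasiSplit F E c 2).Adelic) * (k : (quasiSplit F E c 2).Adelic)))) ∂ν) *
          ((borelHeight (((t : borelAdelic F E c 2) : (quasiSplit F E c 2).Adelic) * (k : (quasiSplit F E c 2).Adelic)) : ℝ) : ℂ) ^ (z - 1) *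
        conj ((∫ v : ↥(adelicUnipotent F E c 2), flatSectionU (fun _ : (quasiSplit F E c 2).Adelic => φ₀') z' ((quasiSplit F E c 2).toAdelic (weylLongU (c : E →+* E) (rfl : (StdForm.antidiagonal 2).over E = (StdForm.antidiagonal 2).over E)) * ((v : (quasiSplit F E c 2).Adelic) * (((t : borelAdelic F E c 2) : (quasiSplit F E c 2).Adelic) * (k : (quasiSplit F E c 2).Adelic)))) ∂ν) *
          ((borelHeight (((t : borelAdelic F E c 2) : (quasiSplit F E c 2).Adelic) * (k : (quasiSplit F E c 2).Adelic)) : ℝ) : ℂ) ^ (z' - 1)) ∂μK =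
      (fun _ : (AdeleRing (𝓞 E) E)ˣ => ((μK.real Set.univ : ℝ) : ℂ) *
          ((∫ v : ↥(adelicUnipotent F E c 2), (((borelHeight ((quasiSplit F E c 2).toAdelic (weylLongU (c : E →+* E) (rfl : (StdForm.antidiagonal 2).over E = (StdForm.antidiagonal 2).over E)) * (v : (quasiSplit F E c 2).Adelic))) : ℝ) : ℂ) ^ z ∂ν) * φ₀ * conj ((∫ v : ↥(adelicUnipotent F E c 2), (((borelHeight ((quasiSplit F E c 2).toAdelic (weylLongU (c : E →+* E) (rfl : (StdForm.antidiagonal 2).over E = (StdForm.antidiagonal 2).over E)) * (v : (quasiSplit F E c 2).Adelic))) : ℝ) : ℂ) ^ z' ∂ν) * φ₀')))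
        (diagUnit (t : borelAdelic F E c 2).2 0) := by
  simp_rw [intertwinedCoeff_const hc hc1 ν hBK φ₀ z, intertwinedCoeff_const hc hc1 ν hBK φ₀' z']
  exact integral_maximalCompact_const μK _




omit [BorelSpace (quasiSplit F E c 2).Adelic] in
/-- **`0 < m = μ_K(K_U)`** (`N = 2`): a Haar measure is positive on the (open, nonempty) whole group and `K_U` is compact (★ `isCompact_comap_adelicVal_standardMaximalCompactGL`). [folklore] -/
theorem measureReal_maximalCompact_pos (μK : Measure ((standardMaximalCompactGL 2 E).comap (adelicVal F E c 2 ((StdForm.antidiagonal 2).over E)) : Subgroup (quasiSplit F E c 2).Adelic)) [μK.IsHaarMeasure] : 0 < μK.real Set.univ := by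
  have hKc : IsCompact (((standardMaximalCompactGL 2 E).comap (adelicVal F E c 2 ((StdForm.antidiagonal 2).over E)) : Subgroup (quasiSplit F E c 2).Adelic) : Set (quasiSplit F E c 2).Adelic) :=
    isCompact_comap_adelicVal_standardMaximalCompactGL
  haveI : CompactSpace ((standardMaximalCompactGL 2 E).comap (adelicVal F E c 2 ((StdForm.antidiagonal 2).over E)) : Subgroup (quasiSplit F E c 2).Adelic) := isCompact_iff_compactSpace.1 hKc
  haveI : IsFiniteMeasure μK := CompactSpace.isFiniteMeasure
  rw [measureReal_def]
  exact ENNReal.toReal_pos (isOpen_univ.measure_pos μK univ_nonempty).ne' (measure_ne_top μK _)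

end Generic

open Summit.HodgeConjecture.HodgeConjecture.Cruxes.H413.K2E1MaassSelbergCMTwoFinalPair (maassSelberg_flatSectionU_cm_two_final' maassSelberg_flatSectionU_cm_two_final_const')

/-! ## §4 (ED. 2) The CM pair: «CM-FINAL-2» ED. 2 at the spherical sections — every `hΞᵢ` discharged, the brackets explicit -/

section CM

variable (L : Type) [Field L] [NumberField L] [IsCMField L]
variable [MeasurableSpace (quasiSplit (↥(maximalRealSubfield L)) L (IsCMField.complexConj L) 2).Adelic] [BorelSpace (quasiSplit (↥(maximalRealSubfield L)) L (IsCMField.complexConj L) 2).Adelic]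
variable [MeasurableSpace (AdeleRing (𝓞 L) L)ˣ] [BorelSpace (AdeleRing (𝓞 L) L)ˣ]

/-- **THE MAASS–SELBERG RELATION FOR THE SPHERICAL FLAT SECTIONS `φ₀·H^z`, `φ₀′·H^{z′}` OF `U(J₂)` AT THE CM PAIR** = ★ p858214 «CM-FINAL-2» ED. 2 `maassSelberg_flatSectionU_cm_two_final′` at the
CONSTANT coefficients with ALL FOUR `K_U`-average data `hΞᵢ` DISCHARGED (§3) and the idele-class brackets explicit `[Ξᵢ] = κ·Ξᵢ`, `κ = ∫_{𝓕_I ∩ {‖x‖ ≤ 1}} ‖x‖ dν_I` (`= ↑κ_ℝ > 0`, ★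
`idelicBracket_eq_ofReal`∕`idelicBracket_pos`), `m = μ_K(K_U) > 0` (§3).  SURVIVOR: `hdec′` ONLY — the `U(J₂)` twin of ★ p858169 `maassSelberg_flatSectionU_cm_three_final_const`.
[cite: MoeglinWaldspurger1995, II.1.6–II.1.7 and IV.2.3] [cite: Garrett2018, §11.3] -/
theorem maassSelberg_flatSectionU_cm_two_final_spherical
    (μ : Measure (quasiSplit (↥(maximalRealSubfield L)) L (IsCMField.complexConj L) 2).automorphicQuotient) [(quasiSplit (↥(maximalRealSubfield L)) L (IsCMField.complexConj L) 2).IsAutomorphicMeasure μ]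
    (νG : Measure (quasiSplit (↥(maximalRealSubfield L)) L (IsCMField.complexConj L) 2).Adelic) [νG.IsHaarMeasure] [νG.IsInvInvariant]
    (μK : Measure ((standardMaximalCompactGL 2 L).comap (adelicVal (↥(maximalRealSubfield L)) L (IsCMField.complexConj L) 2 ((StdForm.antidiagonal 2).over L)) : Subgroup (quasiSplit (↥(maximalRealSubfield L)) L (IsCMField.complexConj L) 2).Adelic))
    [μK.IsHaarMeasure]
    (νI : Measure (AdeleRing (𝓞 L) L)ˣ) [νI.IsHaarMeasure]
    {𝓕I : Set (AdeleRing (𝓞 L) L)ˣ} (h𝓕I : IsIdeleClassDomain L 𝓕I)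
    (ν : Measure ↥(adelicUnipotent (↥(maximalRealSubfield L)) L (IsCMField.complexConj L) 2)) [ν.IsHaarMeasure]
    {𝓕 : Set ↥(adelicUnipotent (↥(maximalRealSubfield L)) L (IsCMField.complexConj L) 2)} (h𝓕N : IsFundamentalDomain ↥(rationalUnipotent (↥(maximalRealSubfield L)) L (IsCMField.complexConj L) 2) 𝓕 ν) (h𝓕1 : ν 𝓕 = 1)
    (h𝓕c : IsCompact (closure 𝓕)) :
    ∃ cμ K : ℝ, 0 < cμ ∧ 0 < K ∧
      ∀ {β : (quasiSplit (↥(maximalRealSubfield L)) L (IsCMField.complexConj L) 2).Adelic → ℝ≥0∞}, IsCoveringWeight ((arithmeticBorel (↥(maximalRealSubfield L)) L (IsCMField.complexConj L) 2).map (quasiSplit (↥(maximalRealSubfield L)) L (IsCMField.complexConj L) 2).arithmeticSubgroup.subtype) β →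
      ∀ {T : ℝ≥0}, 1 ≤ T →
      ∀ (φ₀ φ₀' : ℂ),
      ∀ {z z' : ℂ}, 1 < z'.re → z'.re < z.re →
      -- NAMED: the decay `hdec′` of `E(f′_{z′}) − E(f′_{z′})_B` on `{H > T}` — NOTHING ELSE (the `K_U`-averages are the constants of §3, the brackets explicit)
        ∀ {M₁ : ℝ}, (∀ g : (quasiSplit (↥(maximalRealSubfield L)) L (IsCMField.complexConj L) 2).Adelic, T < borelHeight g →
          ‖eisensteinSeriesU (flatSectionU (fun _ : (quasiSplit (↥(maximalRealSubfield L)) L (IsCMField.complexConj L) 2).Adelic => φ₀') z') g - borelConstantTerm ν 𝓕 (eisensteinSeriesU (flatSectionU (fun _ : (quasiSplit (↥(maximalRealSubfield L)) L (IsCMField.complexConj L) 2).Adelic => φ₀') z')) g‖ ≤ M₁) →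
        ∫ x, (quasiSplit (↥(maximalRealSubfield L)) L (IsCMField.complexConj L) 2).quotFun (truncation ν 𝓕 T (eisensteinSeriesU (flatSectionU (fun _ : (quasiSplit (↥(maximalRealSubfield L)) L (IsCMField.complexConj L) 2).Adelic => φ₀) z))) x * conj ((quasiSplit (↥(maximalRealSubfield L)) L (IsCMField.complexConj L) 2).quotFun (truncation ν 𝓕 T (eisensteinSeriesU (flatSectionU (fun _ : (quasiSplit (↥(maximalRealSubfield L)) L (IsCMField.complexConj L) 2).Adelic => φ₀') z'))) x) ∂μ =
          (cμ : ℂ) * ((K : ℂ) *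
            ((((T : ℝ) : ℂ) ^ (z + conj z' - 1) / (z + conj z' - 1)) * ((∫ x in {x : (AdeleRing (𝓞 L) L)ˣ | (IdeleClassGroup.ideleNorm L x : ℝ) ≤ 1} ∩ 𝓕I, ((IdeleClassGroup.ideleNorm L x : ℝ) : ℂ) ∂νI) * (((μK.real Set.univ : ℝ) : ℂ) * (φ₀ * conj φ₀')))
              + (((T : ℝ) : ℂ) ^ (z - conj z') / (z - conj z')) * ((∫ x in {x : (AdeleRing (𝓞 L) L)ˣ | (IdeleClassGroup.ideleNorm L x : ℝ) ≤ 1} ∩ 𝓕I, ((IdeleClassGroup.ideleNorm L x : ℝ) : ℂ) ∂νI) * (((μK.real Set.univ : ℝ) : ℂ) * (φ₀ * conj ((∫ v : ↥(adelicUnipotent (↥(maximalRealSubfield L)) L (IsCMField.complexConj L) 2), (((borelHeight ((quasiSplit (↥(maximalRealSubfield L)) L (IsCMField.complexConj L) 2).toAdelic (weylLongU ((IsCMField.complexConj L : L ≃ₐ[↥(maximalRealSubfield L)] L) : L →+* L) (rfl : (StdForm.antidiagonal 2).over L = (StdForm.antidiagonal 2).over L)) * (v : (quasiSplit (↥(maximalRealSubfield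 L)) L (IsCMField.complexConj L) 2).Adelic))) : ℝ) : ℂ) ^ z' ∂ν) * φ₀'))))
              - (((T : ℝ) : ℂ) ^ (-(z - conj z')) / (z - conj z')) * ((∫ x in {x : (AdeleRing (𝓞 L) L)ˣ | (IdeleClassGroup.ideleNorm L x : ℝ) ≤ 1} ∩ 𝓕I, ((IdeleClassGroup.ideleNorm L x : ℝ) : ℂ) ∂νI) * (((μK.real Set.univ : ℝ) : ℂ) * ((∫ v : ↥(adelicUnipotent (↥(maximalRealSubfield L)) L (IsCMField.complexConj L) 2), (((borelHeight ((quasiSplit (↥(maximalRealSubfield L)) L (IsCMField.complexConj L) 2).toAdelic (weylLongU ((IsCMField.complexConj L : L ≃ₐ[↥(maximalRealSubfield L)] L) : L →+* L) (rfl : (StdForm.antidiagonal 2).over L = (StdForm.antidiagonal 2).over L)) * (v : (quasiSplit (↥(maximalRealSubfield L)) L (IsCMField.complexConj L) 2).Adelic))) : ℝ) : ℂ) ^ z ∂ν) * φ₀ * conj φ₀')))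
              - (((T : ℝ) : ℂ) ^ (-(z + conj z' - 1)) / (z + conj z' - 1)) * ((∫ x in {x : (AdeleRing (𝓞 L) L)ˣ | (IdeleClassGroup.ideleNorm L x : ℝ) ≤ 1} ∩ 𝓕I, ((IdeleClassGroup.ideleNorm L x : ℝ) : ℂ) ∂νI) * (((μK.real Set.univ : ℝ) : ℂ) * ((∫ v : ↥(adelicUnipotent (↥(maximalRealSubfield L)) L (IsCMField.complexConj L) 2), (((borelHeight ((quasiSplit (↥(maximalRealSubfield L)) L (IsCMField.complexConj L) 2).toAdelic (weylLongU ((IsCMField.complexConj L : L ≃ₐ[↥(maximalRealSubfield L)] L) : L →+* L) (rfl : (StdForm.antidiagonal 2).over L = (StdForm.antidiagonal 2).over L)) * (v : (quasiSplit (↥(maximalRealSubfield L)) L (IsCMField.complexConj L) 2).Adelic))) : ℝ) : ℂ) ^ z ∂ν) * φ₀ * conj ((∫ v : ↥(adelicUnipotent (↥(maximalRealSubfield L)) L (IsCMField.complexConj L) 2), (((borelHeight ((quasiSplit (↥(maximalRealSubfield L)) L (IsCMField.complexConj L) 2).toAdelic (weylLongU ((IsCMField.complexConj L : L ≃ₐ[↥(maximalRealSubfield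 L)] L) : L →+* L) (rfl : (StdForm.antidiagonal 2).over L = (StdForm.antidiagonal 2).over L)) * (v : (quasiSplit (↥(maximalRealSubfield L)) L (IsCMField.complexConj L) 2).Adelic))) : ℝ) : ℂ) ^ z' ∂ν) * φ₀')))))) := by
  obtain ⟨cμ, K, hcμ, hK, h⟩ := maassSelberg_flatSectionU_cm_two_final' L μ νG μK νI h𝓕I ν h𝓕N h𝓕1 h𝓕c
  refine ⟨cμ, K, hcμ, hK, ?_⟩
  intro β hβ T hT φ₀ φ₀' z z' hz' hzz' M₁ hdec'
  have hc : IsCMField.complexConj L * IsCMField.complexConj L = 1 := AlgEquiv.ext fun x => IsCMField.complexConj_apply_apply L x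
  have hc1 : IsCMField.complexConj L ≠ 1 := IsCMField.complexConj_ne_one L
  have hBK := exists_mem_borelAdelic_mul_mem_standardMaximalCompactGL_cm L (N := 2)
  have key := h hβ hT (φ := fun _ : (quasiSplit (↥(maximalRealSubfield L)) L (IsCMField.complexConj L) 2).Adelic => φ₀) (φ' := fun _ : (quasiSplit (↥(maximalRealSubfield L)) L (IsCMField.complexConj L) 2).Adelic => φ₀') continuous_const (fun _ _ => rfl) (fun _ _ _ => rfl) (Cφ := ‖φ₀‖) (fun _ => le_rfl)
    continuous_const (fun _ _ => rfl) (fun _ _ _ => rfl) (Cφ' := ‖φ₀'‖) (fun _ => le_rfl) hz' hzz' hdec'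
    (Ξ₁ := fun _ : (AdeleRing (𝓞 L) L)ˣ => (((μK.real Set.univ : ℝ) : ℂ) * (φ₀ * conj φ₀'))) (Ξ₂ := fun _ : (AdeleRing (𝓞 L) L)ˣ => (((μK.real Set.univ : ℝ) : ℂ) * (φ₀ * conj ((∫ v : ↥(adelicUnipotent (↥(maximalRealSubfield L)) L (IsCMField.complexConj L) 2), (((borelHeight ((quasiSplit (↥(maximalRealSubfield L)) L (IsCMField.complexConj L) 2).toAdelic (weylLongU ((IsCMField.complexConj L : L ≃ₐ[↥(maximalRealSubfield L)] L) : L →+* L) (rfl : (StdForm.antidiagonal 2).over L = (StdForm.antidiagonal 2).over L)) * (v : (quasiSplit (↥(maximalRealSubfield L)) L (IsCMField.complexConj L) 2).Adelic))) : ℝ) : ℂ) ^ z' ∂ν) * φ₀'))))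
    (Ξ₃ := fun _ : (AdeleRing (𝓞 L) L)ˣ => (((μK.real Set.univ : ℝ) : ℂ) * ((∫ v : ↥(adelicUnipotent (↥(maximalRealSubfield L)) L (IsCMField.complexConj L) 2), (((borelHeight ((quasiSplit (↥(maximalRealSubfield L)) L (IsCMField.complexConj L) 2).toAdelic (weylLongU ((IsCMField.complexConj L : L ≃ₐ[↥(maximalRealSubfield L)] L) : L →+* L) (rfl : (StdForm.antidiagonal 2).over L = (StdForm.antidiagonal 2).over L)) * (v : (quasiSplit (↥(maximalRealSubfield L)) L (IsCMField.complexConj L) 2).Adelic))) : ℝ) : ℂ) ^ z ∂ν) * φ₀ * conj φ₀'))) (Ξ₄ := fun _ : (AdeleRing (𝓞 L) L)ˣ => (((μK.real Set.univ : ℝ) : ℂ) * ((∫ v : ↥(adelicUnipotent (↥(maximalRealSubfield L)) L (IsCMField.complexConj L) 2), (((borelHeight ((quasiSplit (↥(maximalRealSubfield L)) L (IsCMField.complexConj L) 2).toAdelic (weylLongU ((IsCMField.complexConj L : L ≃ₐ[↥(maximalRealSubfield L)] L) : L →+* L) (rfl : (StdForm.antidiagonal 2).over L = (StdForm.antidiagonal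 2).over L)) * (v : (quasiSplit (↥(maximalRealSubfield L)) L (IsCMField.complexConj L) 2).Adelic))) : ℝ) : ℂ) ^ z ∂ν) * φ₀ * conj ((∫ v : ↥(adelicUnipotent (↥(maximalRealSubfield L)) L (IsCMField.complexConj L) 2), (((borelHeight ((quasiSplit (↥(maximalRealSubfield L)) L (IsCMField.complexConj L) 2).toAdelic (weylLongU ((IsCMField.complexConj L : L ≃ₐ[↥(maximalRealSubfield L)] L) : L →+* L) (rfl : (StdForm.antidiagonal 2).over L = (StdForm.antidiagonal 2).over L)) * (v : (quasiSplit (↥(maximalRealSubfield L)) L (IsCMField.complexConj L) 2).Adelic))) : ℝ) : ℂ) ^ z' ∂ν) * φ₀'))))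
    measurable_const (CΞ₁ := ‖(((μK.real Set.univ : ℝ) : ℂ) * (φ₀ * conj φ₀'))‖) (fun _ => le_rfl) (fun _ _ _ => rfl) (fun _ _ => rfl) (average_const_mul_conj_const μK φ₀ φ₀')
    measurable_const (CΞ₂ := ‖(((μK.real Set.univ : ℝ) : ℂ) * (φ₀ * conj ((∫ v : ↥(adelicUnipotent (↥(maximalRealSubfield L)) L (IsCMField.complexConj L) 2), (((borelHeight ((quasiSplit (↥(maximalRealSubfield L)) L (IsCMField.complexConj L) 2).toAdelic (weylLongU ((IsCMField.complexConj L : L ≃ₐ[↥(maximalRealSubfield L)] L) : L →+* L) (rfl : (StdForm.antidiagonal 2).over L = (StdForm.antidiagonal 2).over L)) * (v : (quasiSplit (↥(maximalRealSubfield L)) L (IsCMField.complexConj L) 2).Adelic))) : ℝ) : ℂ) ^ z' ∂ν) * φ₀')))‖) (fun _ => le_rfl) (fun _ _ _ => rfl) (fun _ _ => rfl) (average_const_mul_conj_intertwinedCoeff_const hc hc1 ν hBK μK φ₀ φ₀' z')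
    measurable_const (CΞ₃ := ‖(((μK.real Set.univ : ℝ) : ℂ) * ((∫ v : ↥(adelicUnipotent (↥(maximalRealSubfield L)) L (IsCMField.complexConj L) 2), (((borelHeight ((quasiSplit (↥(maximalRealSubfield L)) L (IsCMField.complexConj L) 2).toAdelic (weylLongU ((IsCMField.complexConj L : L ≃ₐ[↥(maximalRealSubfield L)] L) : L →+* L) (rfl : (StdForm.antidiagonal 2).over L = (StdForm.antidiagonal 2).over L)) * (v : (quasiSplit (↥(maximalRealSubfield L)) L (IsCMField.complexConj L) 2).Adelic))) : ℝ) : ℂ) ^ z ∂ν) * φ₀ * conj φ₀'))‖) (fun _ => le_rfl) (fun _ _ _ => rfl) (fun _ _ => rfl) (average_intertwinedCoeff_const_mul_conj_const hc hc1 ν hBK μK φ₀ φ₀' z)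
    measurable_const (CΞ₄ := ‖(((μK.real Set.univ : ℝ) : ℂ) * ((∫ v : ↥(adelicUnipotent (↥(maximalRealSubfield L)) L (IsCMField.complexConj L) 2), (((borelHeight ((quasiSplit (↥(maximalRealSubfield L)) L (IsCMField.complexConj L) 2).toAdelic (weylLongU ((IsCMField.complexConj L : L ≃ₐ[↥(maximalRealSubfield L)] L) : L →+* L) (rfl : (StdForm.antidiagonal 2).over L = (StdForm.antidiagonal 2).over L)) * (v : (quasiSplit (↥(maximalRealSubfield L)) L (IsCMField.complexConj L) 2).Adelic))) : ℝ) : ℂ) ^ z ∂ν) * φ₀ * conj ((∫ v : ↥(adelicUnipotent (↥(maximalRealSubfield L)) L (IsCMField.complexConj L) 2), (((borelHeight ((quasiSplit (↥(maximalRealSubfield L)) L (IsCMField.complexConj L) 2).toAdelic (weylLongU ((IsCMField.complexConj L : L ≃ₐ[↥(maximalRealSubfield L)] L) : L →+* L) (rfl : (StdForm.antidiagonal 2).over L = (StdForm.antidiagonal 2).over L)) * (v : (quasiSplit (↥(maximalRealSubfield L)) L (IsCMField.complexConj L) 2).Adelic))) : ℝ) : ℂ) ^ z' ∂ν) * φ₀')))‖)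 (fun _ => le_rfl) (fun _ _ _ => rfl) (fun _ _ => rfl) (average_intertwinedCoeff_const_mul_conj_intertwinedCoeff_const hc hc1 ν hBK μK φ₀ φ₀' z z')
  simpa only [integral_mul_const] using key

/-- **THE SAME, MODULO ONLY THE MODULARITY OF THE SPHERICAL SECTION**: over ★ p858214 `maassSelberg_flatSectionU_cm_two_final_const′` (whose `hdec′` is PAID by ★ p858035 [D5] ∘ ★ p857911 B′) at
`φ ≡ φ₀` too, all `hΞᵢ` discharged and the brackets explicit — SURVIVOR EXACTLY the modularity `hf′` of `f′_{z′} = φ₀′·H^{z′}` under `B(𝔸)` for a unitary Hecke character `χ` (forcing `χ = 1`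
unless `φ₀′ = 0`): the spherical Maass–Selberg relation of `U(J₂)` at the CM pair is letter-free but for that modularity. [cite: MoeglinWaldspurger1995, I.2.10–I.2.12, II.1.7 and IV.2.1–IV.2.3]
[cite: Garrett2018, §2.9 and §11.3] -/
theorem maassSelberg_flatSectionU_cm_two_final_spherical_of_modular
    (μ : Measure (quasiSplit (↥(maximalRealSubfield L)) L (IsCMField.complexConj L) 2).automorphicQuotient) [(quasiSplit (↥(maximalRealSubfield L)) L (IsCMField.complexConj L) 2).IsAutomorphicMeasure μ]
    (νG : Measure (quasiSplit (↥(maximalRealSubfield L)) L (IsCMField.complexConj L) 2).Adelic) [νG.IsHaarMeasure] [νG.IsInvInvariant]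
    (μK : Measure ((standardMaximalCompactGL 2 L).comap (adelicVal (↥(maximalRealSubfield L)) L (IsCMField.complexConj L) 2 ((StdForm.antidiagonal 2).over L)) : Subgroup (quasiSplit (↥(maximalRealSubfield L)) L (IsCMField.complexConj L) 2).Adelic))
    [μK.IsHaarMeasure]
    (νI : Measure (AdeleRing (𝓞 L) L)ˣ) [νI.IsHaarMeasure]
    {𝓕I : Set (AdeleRing (𝓞 L) L)ˣ} (h𝓕I : IsIdeleClassDomain L 𝓕I)
    (ν : Measure ↥(adelicUnipotent (↥(maximalRealSubfield L)) L (IsCMField.complexConj L) 2)) [ν.IsHaarMeasure]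
    {𝓕 : Set ↥(adelicUnipotent (↥(maximalRealSubfield L)) L (IsCMField.complexConj L) 2)} (h𝓕N : IsFundamentalDomain ↥(rationalUnipotent (↥(maximalRealSubfield L)) L (IsCMField.complexConj L) 2) 𝓕 ν) (h𝓕1 : ν 𝓕 = 1)
    (h𝓕c : IsCompact (closure 𝓕)) :
    ∃ cμ K : ℝ, 0 < cμ ∧ 0 < K ∧
      ∀ {β : (quasiSplit (↥(maximalRealSubfield L)) L (IsCMField.complexConj L) 2).Adelic → ℝ≥0∞}, IsCoveringWeight ((arithmeticBorel (↥(maximalRealSubfield L)) L (IsCMField.complexConj L) 2).map (quasiSplit (↥(maximalRealSubfield L)) L (IsCMField.complexConj L) 2).arithmeticSubgroup.subtype) β →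
      ∀ {T : ℝ≥0}, 1 ≤ T →
      ∀ (φ₀ φ₀' : ℂ),
      ∀ {z z' : ℂ}, 1 < z'.re → z'.re < z.re →
      -- NAMED: the modularity `hf′` of the spherical `f′_{z′} = φ₀′·H^{z′}` under `B(𝔸)` (unitary Hecke character `χ`) — NOTHING ELSE (`hdec′` is ★ p858035 ∘ ★ p857911 B′; the `K_U`-averages are the constants of §3)
        ∀ (χ : GaloisRepresentations.HeckeCharacter L), χ.IsUnitary →
        (∀ (b g : (quasiSplit (↥(maximalRealSubfield L)) L (IsCMField.complexConj L) 2).Adelic) (u : (AdeleRing (𝓞 L) L)ˣ),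
          ((b.1 : GL (Fin 2) (AdeleRing (𝓞 L) L)) : Matrix (Fin 2) (Fin 2) (AdeleRing (𝓞 L) L)) 1 0 = 0 →
          (u : (AdeleRing (𝓞 L) L)) = ((b.1 : GL (Fin 2) (AdeleRing (𝓞 L) L)) : Matrix (Fin 2) (Fin 2) (AdeleRing (𝓞 L) L)) 0 0 →
            flatSectionU (fun _ : (quasiSplit (↥(maximalRealSubfield L)) L (IsCMField.complexConj L) 2).Adelic => φ₀') z' (b * g) = ((χ u : ℂˣ) : ℂ) * ((GaloisRepresentations.ideleNorm u : ℝ) : ℂ) ^ z' * flatSectionU (fun _ : (quasiSplit (↥(maximalRealSubfield L)) L (IsCMField.complexConj L) 2).Adelic => φ₀') z' g) →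
        ∫ x, (quasiSplit (↥(maximalRealSubfield L)) L (IsCMField.complexConj L) 2).quotFun (truncation ν 𝓕 T (eisensteinSeriesU (flatSectionU (fun _ : (quasiSplit (↥(maximalRealSubfield L)) L (IsCMField.complexConj L) 2).Adelic => φ₀) z))) x * conj ((quasiSplit (↥(maximalRealSubfield L)) L (IsCMField.complexConj L) 2).quotFun (truncation ν 𝓕 T (eisensteinSeriesU (flatSectionU (fun _ : (quasiSplit (↥(maximalRealSubfield L)) L (IsCMField.complexConj L) 2).Adelic => φ₀') z'))) x) ∂μ =
          (cμ : ℂ) * ((K : ℂ) *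
            ((((T : ℝ) : ℂ) ^ (z + conj z' - 1) / (z + conj z' - 1)) * ((∫ x in {x : (AdeleRing (𝓞 L) L)ˣ | (IdeleClassGroup.ideleNorm L x : ℝ) ≤ 1} ∩ 𝓕I, ((IdeleClassGroup.ideleNorm L x : ℝ) : ℂ) ∂νI) * (((μK.real Set.univ : ℝ) : ℂ) * (φ₀ * conj φ₀')))
              + (((T : ℝ) : ℂ) ^ (z - conj z') / (z - conj z')) * ((∫ x in {x : (AdeleRing (𝓞 L) L)ˣ | (IdeleClassGroup.ideleNorm L x : ℝ) ≤ 1} ∩ 𝓕I, ((IdeleClassGroup.ideleNorm L x : ℝ) : ℂ) ∂νI) * (((μK.real Set.univ : ℝ) : ℂ) * (φ₀ * conj ((∫ v : ↥(adelicUnipotent (↥(maximalRealSubfield L)) L (IsCMField.complexConj L) 2), (((borelHeight ((quasiSplit (↥(maximalRealSubfield L)) L (IsCMField.complexConj L) 2).toAdelic (weylLongU ((IsCMField.complexConj L : L ≃ₐ[↥(maximalRealSubfield L)] L) : L →+* L) (rfl : (StdForm.antidiagonal 2).over L = (StdForm.antidiagonal 2).over L)) * (v : (quasiSplit (↥(maximalRealSubfield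 L)) L (IsCMField.complexConj L) 2).Adelic))) : ℝ) : ℂ) ^ z' ∂ν) * φ₀'))))
              - (((T : ℝ) : ℂ) ^ (-(z - conj z')) / (z - conj z')) * ((∫ x in {x : (AdeleRing (𝓞 L) L)ˣ | (IdeleClassGroup.ideleNorm L x : ℝ) ≤ 1} ∩ 𝓕I, ((IdeleClassGroup.ideleNorm L x : ℝ) : ℂ) ∂νI) * (((μK.real Set.univ : ℝ) : ℂ) * ((∫ v : ↥(adelicUnipotent (↥(maximalRealSubfield L)) L (IsCMField.complexConj L) 2), (((borelHeight ((quasiSplit (↥(maximalRealSubfield L)) L (IsCMField.complexConj L) 2).toAdelic (weylLongU ((IsCMField.complexConj L : L ≃ₐ[↥(maximalRealSubfield L)] L) : L →+* L) (rfl : (StdForm.antidiagonal 2).over L = (StdForm.antidiagonal 2).over L)) * (v : (quasiSplit (↥(maximalRealSubfield L)) L (IsCMField.complexConj L) 2).Adelic))) : ℝ) : ℂ) ^ z ∂ν) * φ₀ * conj φ₀')))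
              - (((T : ℝ) : ℂ) ^ (-(z + conj z' - 1)) / (z + conj z' - 1)) * ((∫ x in {x : (AdeleRing (𝓞 L) L)ˣ | (IdeleClassGroup.ideleNorm L x : ℝ) ≤ 1} ∩ 𝓕I, ((IdeleClassGroup.ideleNorm L x : ℝ) : ℂ) ∂νI) * (((μK.real Set.univ : ℝ) : ℂ) * ((∫ v : ↥(adelicUnipotent (↥(maximalRealSubfield L)) L (IsCMField.complexConj L) 2), (((borelHeight ((quasiSplit (↥(maximalRealSubfield L)) L (IsCMField.complexConj L) 2).toAdelic (weylLongU ((IsCMField.complexConj L : L ≃ₐ[↥(maximalRealSubfield L)] L) : L →+* L) (rfl : (StdForm.antidiagonal 2).over L = (StdForm.antidiagonal 2).over L)) * (v : (quasiSplit (↥(maximalRealSubfield L)) L (IsCMField.complexConj L) 2).Adelic))) : ℝ) : ℂ) ^ z ∂ν) * φ₀ * conj ((∫ v : ↥(adelicUnipotent (↥(maximalRealSubfield L)) L (IsCMField.complexConj L) 2), (((borelHeight ((quasiSplit (↥(maximalRealSubfield L)) L (IsCMField.complexConj L) 2).toAdelic (weylLongU ((IsCMField.complexConj L : L ≃ₐ[↥(maximalRealSubfield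 L)] L) : L →+* L) (rfl : (StdForm.antidiagonal 2).over L = (StdForm.antidiagonal 2).over L)) * (v : (quasiSplit (↥(maximalRealSubfield L)) L (IsCMField.complexConj L) 2).Adelic))) : ℝ) : ℂ) ^ z' ∂ν) * φ₀')))))) := by
  obtain ⟨cμ, K, hcμ, hK, h⟩ := maassSelberg_flatSectionU_cm_two_final_const' L μ νG μK νI h𝓕I ν h𝓕N h𝓕1 h𝓕c
  refine ⟨cμ, K, hcμ, hK, ?_⟩
  intro β hβ T hT φ₀ φ₀' z z' hz' hzz' χ hχ hf'
  have hc : IsCMField.complexConj L * IsCMField.complexConj L = 1 := AlgEquiv.ext fun x => IsCMField.complexConj_apply_apply L x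
  have hc1 : IsCMField.complexConj L ≠ 1 := IsCMField.complexConj_ne_one L
  have hBK := exists_mem_borelAdelic_mul_mem_standardMaximalCompactGL_cm L (N := 2)
  have key := h hβ hT (φ := fun _ : (quasiSplit (↥(maximalRealSubfield L)) L (IsCMField.complexConj L) 2).Adelic => φ₀) φ₀' continuous_const (fun _ _ => rfl) (fun _ _ _ => rfl) (Cφ := ‖φ₀‖) (fun _ => le_rfl) hz' hzz' χ hχ hf'
    (Ξ₁ := fun _ : (AdeleRing (𝓞 L) L)ˣ => (((μK.real Set.univ : ℝ) : ℂ) * (φ₀ * conj φ₀'))) (Ξ₂ := fun _ : (AdeleRing (𝓞 L) L)ˣ => (((μK.real Set.univ : ℝ) : ℂ) * (φ₀ * conj ((∫ v : ↥(adelicUnipotent (↥(maximalRealSubfield L)) L (IsCMField.complexConj L) 2), (((borelHeight ((quasiSplit (↥(maximalRealSubfield L)) L (IsCMField.complexConj L) 2).toAdelic (weylLongU ((IsCMField.complexConj L : L ≃ₐ[↥(maximalRealSubfield L)] L) : L →+* L) (rfl : (StdForm.antidiagonal 2).over L = (StdForm.antidiagonal 2).over L)) * (v : (quasiSplit (↥(maximalRealSubfield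 L)) L (IsCMField.complexConj L) 2).Adelic))) : ℝ) : ℂ) ^ z' ∂ν) * φ₀'))))
    (Ξ₃ := fun _ : (AdeleRing (𝓞 L) L)ˣ => (((μK.real Set.univ : ℝ) : ℂ) * ((∫ v : ↥(adelicUnipotent (↥(maximalRealSubfield L)) L (IsCMField.complexConj L) 2), (((borelHeight ((quasiSplit (↥(maximalRealSubfield L)) L (IsCMField.complexConj L) 2).toAdelic (weylLongU ((IsCMField.complexConj L : L ≃ₐ[↥(maximalRealSubfield L)] L) : L →+* L) (rfl : (StdForm.antidiagonal 2).over L = (StdForm.antidiagonal 2).over L)) * (v : (quasiSplit (↥(maximalRealSubfield L)) L (IsCMField.complexConj L) 2).Adelic))) : ℝ) : ℂ) ^ z ∂ν) * φ₀ * conj φ₀'))) (Ξ₄ := fun _ : (AdeleRing (𝓞 L) L)ˣ => (((μK.real Set.univ : ℝ) : ℂ) * ((∫ v : ↥(adelicUnipotent (↥(maximalRealSubfield L)) L (IsCMField.complexConj L) 2), (((borelHeight ((quasiSplit (↥(maximalRealSubfield L)) L (IsCMField.complexConj L) 2).toAdelic (weylLongU ((IsCMField.complexConj L : L ≃ₐ[↥(maximalRealSubfield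 L)] L) : L →+* L) (rfl : (StdForm.antidiagonal 2).over L = (StdForm.antidiagonal 2).over L)) * (v : (quasiSplit (↥(maximalRealSubfield L)) L (IsCMField.complexConj L) 2).Adelic))) : ℝ) : ℂ) ^ z ∂ν) * φ₀ * conj ((∫ v : ↥(adelicUnipotent (↥(maximalRealSubfield L)) L (IsCMField.complexConj L) 2), (((borelHeight ((quasiSplit (↥(maximalRealSubfield L)) L (IsCMField.complexConj L) 2).toAdelic (weylLongU ((IsCMField.complexConj L : L ≃ₐ[↥(maximalRealSubfield L)] L) : L →+* L) (rfl : (StdForm.antidiagonal 2).over L = (StdForm.antidiagonal 2).over L)) * (v : (quasiSplit (↥(maximalRealSubfield L)) L (IsCMField.complexConj L) 2).Adelic))) : ℝ) : ℂ) ^ z' ∂ν) * φ₀'))))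
    measurable_const (CΞ₁ := ‖(((μK.real Set.univ : ℝ) : ℂ) * (φ₀ * conj φ₀'))‖) (fun _ => le_rfl) (fun _ _ _ => rfl) (fun _ _ => rfl) (average_const_mul_conj_const μK φ₀ φ₀')
    measurable_const (CΞ₂ := ‖(((μK.real Set.univ : ℝ) : ℂ) * (φ₀ * conj ((∫ v : ↥(adelicUnipotent (↥(maximalRealSubfield L)) L (IsCMField.complexConj L) 2), (((borelHeight ((quasiSplit (↥(maximalRealSubfield L)) L (IsCMField.complexConj L) 2).toAdelic (weylLongU ((IsCMField.complexConj L : L ≃ₐ[↥(maximalRealSubfield L)] L) : L →+* L) (rfl : (StdForm.antidiagonal 2).over L = (StdForm.antidiagonal 2).over L)) * (v : (quasiSplit (↥(maximalRealSubfield L)) L (IsCMField.complexConj L) 2).Adelic))) : ℝ) : ℂ) ^ z' ∂ν) * φ₀')))‖) (fun _ => le_rfl) (fun _ _ _ => rfl) (fun _ _ => rfl) (average_const_mul_conj_intertwinedCoeff_const hc hc1 ν hBK μK φ₀ φ₀' z')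
    measurable_const (CΞ₃ := ‖(((μK.real Set.univ : ℝ) : ℂ) * ((∫ v : ↥(adelicUnipotent (↥(maximalRealSubfield L)) L (IsCMField.complexConj L) 2), (((borelHeight ((quasiSplit (↥(maximalRealSubfield L)) L (IsCMField.complexConj L) 2).toAdelic (weylLongU ((IsCMField.complexConj L : L ≃ₐ[↥(maximalRealSubfield L)] L) : L →+* L) (rfl : (StdForm.antidiagonal 2).over L = (StdForm.antidiagonal 2).over L)) * (v : (quasiSplit (↥(maximalRealSubfield L)) L (IsCMField.complexConj L) 2).Adelic))) : ℝ) : ℂ) ^ z ∂ν) * φ₀ * conj φ₀'))‖) (fun _ => le_rfl) (fun _ _ _ => rfl) (fun _ _ => rfl) (average_intertwinedCoeff_const_mul_conj_const hc hc1 ν hBK μK φ₀ φ₀' z)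
    measurable_const (CΞ₄ := ‖(((μK.real Set.univ : ℝ) : ℂ) * ((∫ v : ↥(adelicUnipotent (↥(maximalRealSubfield L)) L (IsCMField.complexConj L) 2), (((borelHeight ((quasiSplit (↥(maximalRealSubfield L)) L (IsCMField.complexConj L) 2).toAdelic (weylLongU ((IsCMField.complexConj L : L ≃ₐ[↥(maximalRealSubfield L)] L) : L →+* L) (rfl : (StdForm.antidiagonal 2).over L = (StdForm.antidiagonal 2).over L)) * (v : (quasiSplit (↥(maximalRealSubfield L)) L (IsCMField.complexConj L) 2).Adelic))) : ℝ) : ℂ) ^ z ∂ν) * φ₀ * conj ((∫ v : ↥(adelicUnipotent (↥(maximalRealSubfield L)) L (IsCMField.complexConj L) 2), (((borelHeight ((quasiSplit (↥(maximalRealSubfield L)) L (IsCMField.complexConj L) 2).toAdelic (weylLongU ((IsCMField.complexConj L : L ≃ₐ[↥(maximalRealSubfield L)] L) : L →+* L) (rfl : (StdForm.antidiagonal 2).over L = (StdForm.antidiagonal 2).over L)) * (v : (quasiSplit (↥(maximalRealSubfield L)) L (IsCMField.complexConj L) 2).Adelic))) : ℝ) : ℂ) ^ z' ∂ν) * φ₀')))‖)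 (fun _ => le_rfl) (fun _ _ _ => rfl) (fun _ _ => rfl) (average_intertwinedCoeff_const_mul_conj_intertwinedCoeff_const hc hc1 ν hBK μK φ₀ φ₀' z z')
  simpa only [integral_mul_const] using key

end CM

end Summit.HodgeConjecture.HodgeConjecture.Cruxes.H413.K2E1MaassSelbergSphericalBracketsCMTwo

end
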